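import Mathlib.CategoryTheory.Limits.Shapes.Equalizers
import Literature.AlgebraicGeometry.Frobenioids.QuasiTemperoidConnected
import HarnessLib

/-!
# Semi-graphs of anabelioids, §3: concrete coequalizers in `B^temp(Π)`

Mochizuki, *Semi-graphs of anabelioids*, Publ. RIMS **42** (2006), §3, Definition 3.1 (iii) p. 33
[cite: MochizukiSemiAnbd2006, Def 3.1(iii) p.33]: morphisms of temperoids preserve "countable colimits",
and `B^temp(Π)` has them, computed on underlying sets (`BTempLimitsProofs.lean`, abstractly).  This file
gives the EXPLICIT coequalizer of a parallel pair `s, t : U ⇉ V` of `B^temp(Π)` — the countable discrete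
`Π`-set `V/~` of classes for the equivalence relation generated by `s(u) ~ t(u)` (`BTemp.coeqObj`, with
`coeqπ`, `coeqDesc`, `coeq_hom_ext`, `coeqIsColimit`) — so that arguments "on points" can be made about
coequalizers: `coeqπ` is surjective and identifies exactly the generated-equivalent points
(`coeqπ_surjective`, `coeqπ_eq_iff`).  Used by the Čech-extension proof of the Appendix's Theorem A.4
(`QuasiTemperoidsThmA4CechExtension.lean`), where `ψ^*(X) := coeq(K(q₁), K(q₂))`.  (The companion
explicit quotient by a GROUP of automorphisms is `BTempQDPairQuotients.lean`.)  `Π` is any topological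
group; nothing refers to the IUT corpus; no side is taken on any disputed claim.
-/

open CategoryTheory CategoryTheory.Limits

namespace Literature.AnabelianGeometry.SemiGraphs

universe u

namespace BTemp

open Literature.AlgebraicGeometry.Frobenioids.QuasiTemperoid.BTempConnected (hom_ρ hom_ext_apply
  ρ_one_apply ρ_mul_apply)

variable {G : Type u} [Group G] [TopologicalSpace G] [IsTopologicalGroup G]

/-! ### Concrete coequalizers in `B^temp(Π)` -/

section Coequalizer

variable {U V : BTemp G} (s t : U ⟶ V)

/-- The one-step relation `s(u) ~ t(u)` on the points of `V` for a parallel pair `s, t : U ⇉ V` of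
`B^temp(Π)`. [cite: MochizukiSemiAnbd2006, Def 3.1(iii) p.33] -/
def CoeqRel (v v' : V.obj.V) : Prop :=
  ∃ u : U.obj.V, (s.hom.hom u : V.obj.V) = v ∧ (t.hom.hom u : V.obj.V) = v'

omit [IsTopologicalGroup G] in
/-- The one-step relation is `Π`-invariant. [cite: MochizukiSemiAnbd2006, Def 3.1(iii) p.33] -/
theorem CoeqRel.ρ {v v' : V.obj.V} (h : CoeqRel s t v v') (g : G) :
    CoeqRel s t (V.obj.ρ g v) (V.obj.ρ g v') := by
  obtain ⟨u, rfl, rfl⟩ := h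
  exact ⟨U.obj.ρ g u, hom_ρ s g u, hom_ρ t g u⟩

/-- The carrier of the coequalizer: points of `V` modulo the equivalence relation generated by
`s(u) ~ t(u)`. [cite: MochizukiSemiAnbd2006, Def 3.1(iii) p.33] -/
def CoeqSpace : Type u := Quot (CoeqRel s t)

/-- The class map `V → V/~`. [cite: MochizukiSemiAnbd2006, Def 3.1(iii) p.33] -/
def coeqMk (v : V.obj.V) : CoeqSpace s t := Quot.mk _ v

/-- The `Π`-action descends to the classes. [cite: MochizukiSemiAnbd2006, Def 3.1(iii) p.33] -/
def coeqAct (g : G) : CoeqSpace s t → CoeqSpace s t :=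
  Quot.lift (fun v => coeqMk s t (V.obj.ρ g v)) fun _ _ h => Quot.sound (h.ρ s t g)

omit [IsTopologicalGroup G] in
/-- `g · [v] = [g · v]`. [cite: MochizukiSemiAnbd2006, Def 3.1(iii) p.33] -/
theorem coeqAct_mk (g : G) (v : V.obj.V) : coeqAct s t g (coeqMk s t v) = coeqMk s t (V.obj.ρ g v) :=
  rfl

/-- The induced `Π`-action on the classes (used to build the object; not an instance).
[cite: MochizukiSemiAnbd2006, Def 3.1(iii) p.33] -/
@[reducible] def coeqSpaceMulAction : MulAction G (CoeqSpace s t) where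
  smul g := coeqAct s t g
  one_smul q := by
    induction q using Quot.ind with
    | _ v => exact congrArg (coeqMk s t) (ρ_one_apply V v)
  mul_smul g h q := by
    induction q using Quot.ind with
    | _ v => exact congrArg (coeqMk s t) (ρ_mul_apply V g h v)

/-- **The coequalizer object of `s, t : U ⇉ V` in `B^temp(Π)`**: the classes with the induced
action — countable as a quotient of a countable set, open stabilisers because `Stab([v]) ⊇ Stab(v)`.
[cite: MochizukiSemiAnbd2006, Def 3.1(iii) p.33] -/
def coeqObj : BTemp G :=
  ⟨@Action.ofMulAction G (CoeqSpace s t) _ (coeqSpaceMulAction s t), by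
    letI : MulAction G (CoeqSpace s t) := coeqSpaceMulAction s t
    refine ⟨?_, ?_⟩
    · haveI : Countable V.obj.V := V.property.1
      exact (Quot.mk_surjective (r := CoeqRel s t)).countable
    · intro q
      induction q using Quot.ind with
      | _ v =>
        letI : MulAction G V.obj.V := Action.instMulAction V.obj
        have hle : MulAction.stabilizer G v ≤ MulAction.stabilizer G (coeqMk s t v) := by
          intro g hg
          rw [MulAction.mem_stabilizer_iff] at hg ⊢
          change coeqAct s t g (coeqMk s t v) = coeqMk s t v
          rw [coeqAct_mk]
          exact congrArg (coeqMk s t) hg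
        exact Subgroup.isOpen_mono hle (V.property.2 v)⟩

/-- The coequalizer arrow `V → V/~`. [cite: MochizukiSemiAnbd2006, Def 3.1(iii) p.33] -/
def coeqπ : V ⟶ coeqObj s t :=
  ObjectProperty.homMk
    { hom := TypeCat.ofHom (coeqMk s t)
      comm := fun g => by
        apply ConcreteCategory.hom_ext
        intro x
        rfl }

/-- The coequalizer arrow is the class map on points. [cite: MochizukiSemiAnbd2006, Def 3.1(iii) p.33] -/
@[simp] theorem coeqπ_apply (v : V.obj.V) :
    ((coeqπ s t).hom.hom v : (coeqObj s t).obj.V) = coeqMk s t v := rfl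

/-- `s ≫ π = t ≫ π`. [cite: MochizukiSemiAnbd2006, Def 3.1(iii) p.33] -/
@[reassoc] theorem coeq_condition : s ≫ coeqπ s t = t ≫ coeqπ s t :=
  hom_ext_apply fun u => Quot.sound ⟨u, rfl, rfl⟩

/-- Every class has a representative. [cite: MochizukiSemiAnbd2006, Def 3.1(iii) p.33] -/
theorem coeqπ_surjective (q : (coeqObj s t).obj.V) :
    ∃ v : V.obj.V, ((coeqπ s t).hom.hom v : (coeqObj s t).obj.V) = q :=
  Quot.exists_rep q

/-- Two points have the same class iff they are related by the equivalence relation GENERATED by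
the one-step relation. [cite: MochizukiSemiAnbd2006, Def 3.1(iii) p.33] -/
theorem coeqπ_eq_iff {v v' : V.obj.V} :
    ((coeqπ s t).hom.hom v : (coeqObj s t).obj.V) = (coeqπ s t).hom.hom v' ↔
      Relation.EqvGen (CoeqRel s t) v v' :=
  ⟨fun h => Quot.eqvGen_exact h, fun h => Quot.eqvGen_sound h⟩

/-- Descent of an arrow coequalising `s, t` through `V/~`. [cite: MochizukiSemiAnbd2006, Def 3.1(iii) p.33] -/
def coeqDesc {W : BTemp G} (k : V ⟶ W) (hk : s ≫ k = t ≫ k) : coeqObj s t ⟶ W :=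
  ObjectProperty.homMk
    { hom := TypeCat.ofHom (Quot.lift (fun v => (k.hom.hom v : W.obj.V)) (by
        rintro v v' ⟨u, rfl, rfl⟩
        exact congrArg (fun χ : U ⟶ W => (χ.hom.hom u : W.obj.V)) hk))
      comm := fun g => by
        apply ConcreteCategory.hom_ext
        intro q
        induction q using Quot.ind with
        | _ v => exact hom_ρ k g v }

/-- The descended arrow on classes. [cite: MochizukiSemiAnbd2006, Def 3.1(iii) p.33] -/
@[simp] theorem coeqDesc_apply {W : BTemp G} (k : V ⟶ W) (hk : s ≫ k = t ≫ k) (v : V.obj.V) :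
    ((coeqDesc s t k hk).hom.hom (coeqMk s t v) : W.obj.V) = k.hom.hom v := rfl

/-- `π ≫ desc k = k`. [cite: MochizukiSemiAnbd2006, Def 3.1(iii) p.33] -/
@[reassoc (attr := simp)] theorem coeqπ_desc {W : BTemp G} (k : V ⟶ W) (hk : s ≫ k = t ≫ k) :
    coeqπ s t ≫ coeqDesc s t k hk = k :=
  hom_ext_apply fun _ => rfl

/-- An arrow out of `V/~` is determined by its composite with `π`. [cite: MochizukiSemiAnbd2006, Def 3.1(iii) p.33] -/
theorem coeq_hom_ext {W : BTemp G} {χ χ' : coeqObj s t ⟶ W}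
    (h : coeqπ s t ≫ χ = coeqπ s t ≫ χ') : χ = χ' :=
  hom_ext_apply fun q => by
    induction q using Quot.ind with
    | _ v => exact congrArg (fun ψ : V ⟶ W => (ψ.hom.hom v : W.obj.V)) h

/-- **`V → V/~` is a coequalizer of `s, t` in `B^temp(Π)`.** [cite: MochizukiSemiAnbd2006, Def 3.1(iii) p.33] -/
noncomputable def coeqIsColimit : IsColimit (Cofork.ofπ (coeqπ s t) (coeq_condition s t)) :=
  Cofork.IsColimit.mk _ (fun c => coeqDesc s t c.π c.condition) (fun c => coeqπ_desc s t _ _)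
    fun c m hm => by
      apply coeq_hom_ext s t
      rw [coeqπ_desc]
      exact hm

end Coequalizer

end BTemp

end Literature.AnabelianGeometry.SemiGraphs
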